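import Mathlib.AlgebraicGeometry.ValuativeCriterion
import Mathlib.AlgebraicGeometry.Morphisms.Proper
import Mathlib.AlgebraicGeometry.Morphisms.SchemeTheoreticallyDominant
import Mathlib.AlgebraicGeometry.Morphisms.Flat
import Mathlib.RingTheory.Valuation.ValuationSubring
import Mathlib.RingTheory.LocalRing.ResidueField.Basic
import Literature.AlgebraicGeometry.Resolution.CompositeValuations
import HarnessLib

/-!
# The refined valuative criterion (Stacks 0894)

Topic: `Literature/AlgebraicGeometry/Morphisms`. The Stacks Project, Tag 0894 (Morphisms of Schemes,
Lemma 29.43.2, "refined valuative criterion"):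

> "Let `f : X → S` and `h : U → X` be morphisms of schemes. Assume that `f` and `h` are
> quasi-compact and that `h(U)` is dense in `X`. If given any commutative solid diagram
> `Spec(K) → U → X`, `Spec(A) → S` (with `A` a valuation ring with field of fractions `K`) there
> exists a unique dotted arrow [`Spec(A) → X`] making the diagram commute, then `f` is
> universally closed. If moreover `f` is quasi-separated, then `f` is separated."

This is the criterion by which the Stacks Project's proof of Nagata's compactification theorem
shows that the glued scheme `W` of Tag 0F40 is proper over `S` ("there is an `i` and an extension
of `γ` to a morphism `hᵢ : Spec(A) → Wᵢ` […] This implies that `W → S` is universally closed by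
Morphisms, Lemma 43.2"). Mathlib has the valuative criteria for ALL squares (Tags 01KE, 01KF,
0BX5: `UniversallyClosed.of_valuativeCriterion`, `IsProper.of_valuativeCriterion`) but not this
refinement, in which only the `K`-points coming from a dense `U` are tested.

We prove the universal-closedness (and properness) conclusion in the form needed there: `h`
quasi-compact and SCHEME-THEORETICALLY DOMINANT (for a reduced `X` this is "`h(U)` dense", Mathlib
`isSchemeTheoreticallyDominant_iff_isDominant`; the printed proof begins by passing to reductions
precisely in order to get there, Tag 0894, proof, first paragraph — this preliminary reduction is
the only part not carried out here), `f` quasi-compact and SEPARATED (so that the uniqueness half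
of the hypothesis holds automatically, Tag 01KZ, Mathlib `IsSeparated.valuativeCriterion`), and the
hypothesis asks only for the EXISTENCE of the dotted arrow.

-- TODO(general form): `h(U)` merely dense (pass to `X_red`), `f` quasi-separated with uniqueness
-- assumed instead of separatedness, and the separatedness conclusion of Tag 0894.

## The printed proof and its rendering

Following Tag 0894 verbatim. Given a valuative square (`Spec K → X`, `Spec A → S`):
* replace `S` by an affine open through which `Spec A → S` factors
  (`existence_of_existence_comp`, reduction to `existence_of_existence_comp_of_isAffine`);
* let `Spec B ⊆ X` be an affine open through which `Spec K → X` factors, `P = B[t_k : k ∈ K]` a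
  polynomial algebra with a `B`-algebra SURJECTION `e : P → K`, `𝔭 = ker e`; `g : Spec P → X` is
  flat, so the base change `U ×_X Spec P → Spec P` of `h` is still quasi-compact and
  scheme-theoretically dominant (Tag 081H, Mathlib `IsSchemeTheoreticallyDominant.pullbackSnd`),
  hence dominant, and `𝔭` is a specialisation of the image of a point `t` (Tag 02JQ, here
  `exists_specializes_of_denseRange`);
* (Tag 02JQ continued, Algebra 00IA) the local ring `P_𝔭 → κ(t)` is dominated by a valuation ring
  `A'` of `K' = κ(t)` (Mathlib `IsLocalRing.exists_factor_valuationRing`); since `P → A'` is centred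
  on `𝔭 = ker e`, it induces `φ : K = P/𝔭 → κ(A')`;
* choose a valuation ring `A''` of `κ(A')` dominating `φ(A)` and form the COMPOSITE valuation ring
  `C = {λ ∈ A' | λ mod 𝔪_{A'} ∈ A''}` of `K'` (Algebra, Tag 088Z / 00IA; the tree's `residueOverringLift`);
* the square (`Spec K' → U`, `Spec C → S`) commutes, so by hypothesis it has a lift
  `ℓ : Spec C → X`; by separatedness the `A'`-point `Spec A' → Spec C → X` is the one through
  `Spec P` (`huniq`), whence the `A''`-point `ψ : Spec A'' = Spec (C/𝔪_{A'}) → X` restricts on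
  `Spec κ(A')` to `Spec κ(A') → Spec K → X` and lies over `Spec A'' → Spec A → S`;
* finally ("the image of `𝒪_{X,x} → A''` is contained in `K ∩ A'' = A`"): the `A''`-point gives, in
  `X ×_S Spec A`, a specialisation of the `K`-point to a point over the closed point of `Spec A`,
  and one valuative square lifts as soon as such a specialisation exists — this last step is the
  one-square content of Mathlib's proof of Tag 01KE (`ValuativeCriterion.Existence.of_specializingMap`),
  isolated here as `hasLift_of_specializes` with Mathlib's proof followed verbatim.

## Main results (all proved; no named facts)

* `compositeInclusion`, `compositeToResidue`, `compositeToResidue_surjective` — the two ring maps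
  of the composite valuation ring `C` of a valuation ring of `K` with a valuation ring of its
  residue field (Stacks 088Z/00IA; the ring `C` itself is the tree's
  `Literature.AlgebraicGeometry.Resolution.residueOverringLift`).
* `hasLift_of_specializes` — one valuative square lifts from a specialisation in the base change.
* `ker_preimage_eq_asIdeal`, `exists_specializes_of_denseRange` (Tag 02JQ, topological part).
* `existence_of_existence_comp_of_isAffine`, `existence_of_existence_comp` — **Stacks 0894**,
  existence part of the valuative criterion for `f` from lifts of the squares through `U`.
* `universallyClosed_of_valuativeCriterion_comp`, `isProper_of_valuativeCriterion_comp` —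
  **Stacks 0894**: `f` is universally closed, resp. proper if also locally of finite type.

## References

* The Stacks Project, Tags 0894, 02JQ, 088Z, 00IA, 01KE, 01KF, 01KZ, 081H, 0F40. [StacksProject]
* A. Grothendieck, J. Dieudonné, EGA II (Publ. Math. IHÉS 8, 1961), Thm. 7.3.8 and Rem. 7.3.9.
  [EGAII]
-/

noncomputable section

open CategoryTheory CategoryTheory.Limits IsLocalRing AlgebraicGeometry

universe u

namespace Literature.AlgebraicGeometry.Morphisms

open Literature.AlgebraicGeometry.Resolution (residueOverringLift mem_residueOverringLift_iff
  residueOverringLift_le)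

/-! ### Composite valuation rings (Stacks 088Z / Algebra 00IA) -/

section Composite

variable {K : Type*} [Field K] (A : ValuationSubring K)
  (B : ValuationSubring (IsLocalRing.ResidueField A))

/-! The composite `C = {x ∈ A | x mod 𝔪_A ∈ B}` of a valuation ring `A` of `K` with a valuation
ring `B` of the residue field of `A` is a valuation ring of `K` (Stacks, Tag 088Z; used in the
proof of Tag 0894 as "which is a valuation ring by Algebra, Lemma 50.10"). The tree already has
this construction, as `Literature.AlgebraicGeometry.Resolution.residueOverringLift A B`
(`Literature/AlgebraicGeometry/Resolution/CompositeValuations.lean`, with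
`mem_residueOverringLift_iff`, `residueOverringLift_le`); we only add the two ring maps
`C → A` and `C → B` it comes with. -/

/-- Residues of elements of the composite valuation ring `C` lie in `B`.
[cite: StacksProject, Tag 088Z] -/
theorem residue_mem_of_mem_residueOverringLift {x : K} (hx : x ∈ residueOverringLift A B) :
    IsLocalRing.residue A ⟨x, residueOverringLift_le A B hx⟩ ∈ B :=
  ((mem_residueOverringLift_iff A B x).mp hx).2

/-- The inclusion `C → A` of the composite valuation ring. [cite: StacksProject, Tag 088Z] -/
def compositeInclusion : residueOverringLift A B →+* A :=
  Subring.inclusion (show (residueOverringLift A B).toSubring ≤ A.toSubring from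
    residueOverringLift_le A B)

/-- The surjection `C → B`, `x ↦ x mod 𝔪_A` (so that `B = C/𝔪_A`). [cite: StacksProject, Tag 088Z] -/
def compositeToResidue : residueOverringLift A B →+* B :=
  ((IsLocalRing.residue A).comp (compositeInclusion A B)).codRestrict B.toSubring
    (fun x => residue_mem_of_mem_residueOverringLift A B x.2)

/-- `C → B ⊆ κ(A)` is `C ⊆ A → κ(A)`. [folklore] -/
theorem subtype_comp_compositeToResidue :
    B.subtype.comp (compositeToResidue A B) =
      (IsLocalRing.residue A).comp (compositeInclusion A B) := rfl

/-- `C → A ⊆ K` is `C ⊆ K`. [folklore] -/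
theorem subtype_comp_compositeInclusion :
    A.subtype.comp (compositeInclusion A B) = (residueOverringLift A B).subtype := rfl

/-- `C → B` is surjective. [cite: StacksProject, Tag 088Z] -/
theorem compositeToResidue_surjective : Function.Surjective (compositeToResidue A B) := by
  intro b
  obtain ⟨a, ha⟩ := IsLocalRing.residue_surjective (R := A) b.1
  refine ⟨⟨a.1, (mem_residueOverringLift_iff A B _).mpr ⟨a.2, by simp [ha]⟩⟩, Subtype.ext ?_⟩
  change IsLocalRing.residue A ⟨a.1, a.2⟩ = b.1
  exact ha

end Composite

/-! ### One valuative square lifts from a specialisation (the one-square content of Stacks 01KE) -/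

set_option backward.isDefEq.respectTransparency false in
/-- **One valuative square lifts as soon as its `K`-point specializes, in `X ×_Y Spec R`, to a
point over the closed point of `Spec R`.** This is the content, for a single square, of the
implication "specializations lift ⇒ existence part of the valuative criterion" (Stacks 01KE;
Mathlib `ValuativeCriterion.Existence.of_specializingMap`, whose proof is followed verbatim):
the stalk `𝒪_{X ×_Y Spec R, x} → K` has image the valuation ring `R` (maximality of valuation
rings for domination), giving `Spec R → Spec 𝒪_{X ×_Y Spec R, x} → X`.
[cite: StacksProject, Tag 01KE (proof)] -/
theorem hasLift_of_specializes {X Y : Scheme.{u}} {f : X ⟶ Y}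
    (sq : ValuativeCommSq f) (x : ↑(pullback sq.i₂ f))
    (h₁ : (pullback.lift (Spec.map (CommRingCat.ofHom (algebraMap sq.R sq.K))) sq.i₁
      sq.commSq.w.symm) (closedPoint sq.K) ⤳ x)
    (h₂ : pullback.fst sq.i₂ f x = closedPoint sq.R) : sq.commSq.HasLift := by
  obtain ⟨R, K, i₁, i₂, ⟨w⟩⟩ := sq
  haveI : IsDomain (CommRingCat.of R) := ‹_›
  haveI : ValuationRing (CommRingCat.of R) := ‹_›
  letI : Field (CommRingCat.of K) := ‹_›
  dsimp only at x h₁ h₂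
  let lft := pullback.lift (Spec.map (CommRingCat.ofHom (algebraMap R K))) i₁ w.symm
  change lft (closedPoint K) ⤳ x at h₁
  let e : CommRingCat.of R ≅ (Spec <| .of R).presheaf.stalk (pullback.fst i₂ f x) :=
    (stalkClosedPointIso (.of R)).symm ≪≫
      (Spec <| .of R).presheaf.stalkCongr (.of_eq h₂.symm)
  let α := e.hom ≫ (pullback.fst i₂ f).stalkMap x
  have : IsLocalHom e.hom.hom := isLocalHom_of_isIso e.hom
  have : IsLocalHom α.hom := inferInstanceAs
    (IsLocalHom (((pullback.fst i₂ f).stalkMap x).hom.comp e.hom.hom))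
  let β := (pullback i₂ f).presheaf.stalkSpecializes h₁ ≫ Scheme.stalkClosedPointTo lft
  have hαβ : α ≫ β = CommRingCat.ofHom (algebraMap R K) := by
    simp only [CommRingCat.coe_of, Iso.trans_hom, Iso.symm_hom, TopCat.Presheaf.stalkCongr_hom,
      Category.assoc, α, e, β, stalkClosedPointIso_inv, StructureSheaf.toStalk]
    change (Scheme.ΓSpecIso (.of R)).inv ≫ (Spec <| .of R).presheaf.germ _ _ _ ≫ _ = _
    simp only [TopCat.Presheaf.germ_stalkSpecializes_assoc, Scheme.Hom.germ_stalkMap_assoc]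
    simp only [TopologicalSpace.Opens.map_top]
    rw [Scheme.germ_stalkClosedPointTo lft ⊤ trivial]
    erw [← Scheme.Hom.comp_app_assoc lft (pullback.fst i₂ f)]
    rw [pullback.lift_fst]
    simp
  have hbij := (bijective_rangeRestrict_comp_of_valuationRing (R := R) (K := K) α.hom β.hom
    (CommRingCat.hom_ext_iff.mp hαβ))
  let φ : (pullback i₂ f).presheaf.stalk x ⟶ CommRingCat.of R := CommRingCat.ofHom <|
    (RingEquiv.ofBijective _ hbij).symm.toRingHom.comp β.hom.rangeRestrict
  have hαφ : α ≫ φ = 𝟙 _ := by ext x; exact (RingEquiv.ofBijective _ hbij).symm_apply_apply x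
  have hαφ' : (pullback.fst i₂ f).stalkMap x ≫ φ = e.inv := by
    rw [← cancel_epi e.hom, ← Category.assoc, hαφ, e.hom_inv_id]
  have hφβ : φ ≫ CommRingCat.ofHom (algebraMap R K) = β :=
    hαβ ▸ CommRingCat.hom_ext (RingHom.ext fun x ↦ congr_arg Subtype.val
      ((RingEquiv.ofBijective _ hbij).apply_symm_apply (β.hom.rangeRestrict x)))
  refine ⟨⟨⟨Spec.map ((pullback.snd i₂ f).stalkMap x ≫ φ) ≫ X.fromSpecStalk _, ?_, ?_⟩⟩⟩
  · simp only [← Spec.map_comp_assoc, Category.assoc, hφβ]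
    simp only [Spec.map_comp, Category.assoc, Scheme.SpecMap_stalkMap_fromSpecStalk,
      Scheme.SpecMap_stalkSpecializes_fromSpecStalk_assoc, β]
    rw [Scheme.Spec_stalkClosedPointTo_fromSpecStalk_assoc]
    simp [lft]
  · simp only [Spec.map_comp, Category.assoc, Scheme.SpecMap_stalkMap_fromSpecStalk,
      ← pullback.condition]
    rw [← Scheme.SpecMap_stalkMap_fromSpecStalk_assoc, ← Spec.map_comp_assoc, hαφ']
    simp only [Iso.trans_inv, TopCat.Presheaf.stalkCongr_inv, Iso.symm_inv, Spec.map_comp,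
      Category.assoc, Scheme.SpecMap_stalkSpecializes_fromSpecStalk_assoc, e]
    rw [← Spec_stalkClosedPointIso, ← Spec.map_comp_assoc,
      Iso.inv_hom_id, Spec.map_id, Category.id_comp]

/-! ### Two small lemmas on points of `Spec` -/

/-- The kernel of the ring map underlying a morphism `Spec F → Spec P`, `F` a field, is the
prime ideal of its image point. [folklore] -/
theorem ker_preimage_eq_asIdeal {P : CommRingCat.{u}} {F : Type u} [Field F]
    (m : Spec (.of F) ⟶ Spec P) (p : Spec (.of F)) :
    RingHom.ker (Spec.preimage m).hom = (m p).asIdeal := by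
  obtain ⟨φ, rfl⟩ := Spec.map_surjective m
  rw [Spec.preimage_map]
  have hp : p.asIdeal = ⊥ := Ideal.eq_bot_of_prime _
  change RingHom.ker φ.hom = Ideal.comap φ.hom p.asIdeal
  rw [hp, ← RingHom.ker_eq_comap_bot]

/-- **Points in the closure of the image of a quasi-compact morphism to an affine scheme are
specialisations of image points** (Stacks 02JQ, topological part): for `m : T → Spec P`
quasi-compact with dense image and any `p`, there is `t` with `m t ⤳ p`. [cite: StacksProject, Tag 02JQ] -/
theorem exists_specializes_of_denseRange {T : Scheme.{u}} {P : CommRingCat.{u}} (m : T ⟶ Spec P)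
    [QuasiCompact m] (hm : DenseRange m) (p : Spec P) : ∃ t : T, m t ⤳ p := by
  haveI : CompactSpace T := QuasiCompact.compactSpace_of_compactSpace m
  -- a surjection from an affine scheme onto the quasi-compact `T`
  obtain ⟨R, q, hq⟩ := (compactSpace_iff_exists (X := T)).mp inferInstance
  obtain ⟨φ, hφ⟩ := Spec.map_surjective (q ≫ m)
  have hrange : Set.range m = Set.range (Spec.map φ) := by
    rw [hφ, Scheme.Hom.comp_base, TopCat.coe_comp, Set.range_comp, hq.range_eq, Set.image_univ]
  -- `p` lies in the closure `V(ker φ)` of the image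
  have hp : p ∈ PrimeSpectrum.zeroLocus (RingHom.ker φ.hom : Set P) := by
    rw [← PrimeSpectrum.closure_range_comap]
    have : p ∈ closure (Set.range m) := by rw [hm.closure_eq]; trivial
    rwa [hrange] at this
  have hp' : Ideal.comap φ.hom ⊥ ≤ p.asIdeal := by
    rw [← RingHom.ker_eq_comap_bot]
    exact fun x hx => hp hx
  obtain ⟨Q, -, hQ, hQle⟩ := Ideal.exists_ideal_comap_le_prime p.asIdeal ⊥ hp'
  refine ⟨q ⟨Q, hQ⟩, ?_⟩
  rw [← Scheme.Hom.comp_apply, ← hφ]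
  exact (PrimeSpectrum.le_iff_specializes _ _).mp hQle

/-! ### The refined valuative criterion (Stacks 0894), affine base -/

section Core

variable {U X S : Scheme.{u}} (h : U ⟶ X) (f : X ⟶ S)

set_option backward.isDefEq.respectTransparency false in
set_option maxHeartbeats 800000 in
/-- **Stacks 0894 over an affine base** (the core of the printed proof, see the module docstring
for the step-by-step correspondence): for `S` affine, `h : U → X` quasi-compact and
scheme-theoretically dominant and `f : X → S` separated, if every valuative square
(`Spec K → U → X`, `Spec A → S`) has a lift `Spec A → X`, then `f` satisfies the existence part of
the valuative criterion. [cite: StacksProject, Tag 0894 (proof)] -/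
theorem existence_of_existence_comp_of_isAffine [IsAffine S] [QuasiCompact h]
    [IsSchemeTheoreticallyDominant h] [IsSeparated f]
    (H : ∀ ⦃A K : Type u⦄ [CommRing A] [IsDomain A] [ValuationRing A] [Field K] [Algebra A K]
      [IsFractionRing A K] (u : Spec (.of K) ⟶ U) (s : Spec (.of A) ⟶ S),
      u ≫ h ≫ f = Spec.map (CommRingCat.ofHom (algebraMap A K)) ≫ s →
      ∃ l : Spec (.of A) ⟶ X, Spec.map (CommRingCat.ofHom (algebraMap A K)) ≫ l = u ≫ h ∧
        l ≫ f = s) :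
    ValuativeCriterion.Existence f := by
  intro sq
  have w : sq.i₁ ≫ f = Spec.map (CommRingCat.ofHom (algebraMap sq.R sq.K)) ≫ sq.i₂ := sq.commSq.w
  -- Step 1: an affine chart `Spec B ↪ X` containing the `K`-point, and the point map `b₁ : B → K`
  obtain ⟨_, ⟨V, hV, rfl⟩, hxV, -⟩ := X.isBasis_affineOpens.exists_subset_of_mem_open
    (Set.mem_univ (sq.i₁ (closedPoint sq.K))) isOpen_univ
  have hrange : Set.range sq.i₁ ⊆ Set.range hV.fromSpec := by
    rintro _ ⟨p, rfl⟩
    rw [hV.range_fromSpec, Subsingleton.elim p (closedPoint sq.K)]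
    exact hxV
  set b₁ : Γ(X, V) ⟶ CommRingCat.of sq.K := Spec.preimage (IsOpenImmersion.lift hV.fromSpec sq.i₁ hrange)
    with hb₁
  have hb₁fac : Spec.map b₁ ≫ hV.fromSpec = sq.i₁ := by
    rw [hb₁, Spec.map_preimage, IsOpenImmersion.lift_fac]
  -- Step 2: the flat `g : Spec P → X`, `P = B[t_k : k ∈ K]`, with `P → K` surjective
  letI algBK : Algebra Γ(X, V) sq.K := b₁.hom.toAlgebra
  set P : CommRingCat.{u} := CommRingCat.of (MvPolynomial sq.K Γ(X, V)) with hP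
  set e : P ⟶ CommRingCat.of sq.K :=
    CommRingCat.ofHom (MvPolynomial.aeval (R := Γ(X, V)) (fun k : sq.K => k)).toRingHom with he_def
  have he : Function.Surjective e.hom := fun k =>
    ⟨MvPolynomial.X k, show (MvPolynomial.aeval (R := Γ(X, V)) (fun k : sq.K => k))
      (MvPolynomial.X k) = k from MvPolynomial.aeval_X _ k⟩
  set inclP : Γ(X, V) ⟶ P := CommRingCat.ofHom (algebraMap Γ(X, V) (MvPolynomial sq.K Γ(X, V)))
    with hinclP_def
  have hinclP : inclP ≫ e = b₁ := by
    ext x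
    change (MvPolynomial.aeval (R := Γ(X, V)) (fun k : sq.K => k))
      (algebraMap Γ(X, V) (MvPolynomial sq.K Γ(X, V)) x) = b₁.hom x
    rw [AlgHom.commutes]
    rfl
  -- `g` is kept opaque (only `hg` unfolds it)
  obtain ⟨g, hg⟩ : ∃ g : Spec P ⟶ X, g = Spec.map inclP ≫ hV.fromSpec := ⟨_, rfl⟩
  let 𝔭 : Spec P := ⟨RingHom.ker e.hom, RingHom.ker_isPrime _⟩
  haveI h𝔭 : 𝔭.asIdeal.IsPrime := 𝔭.isPrime
  haveI : Flat (Spec.map inclP) := by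
    rw [Flat.SpecMap_iff]
    change (algebraMap Γ(X, V) (MvPolynomial sq.K Γ(X, V))).Flat
    rw [RingHom.flat_algebraMap_iff]
    infer_instance
  haveI : Flat g := by rw [hg]; infer_instance
  have hi₁ : sq.i₁ = Spec.map e ≫ g := by
    rw [hg, ← Spec.map_comp_assoc, hinclP, hb₁fac]
  -- Step 3: a point `t` of `T = U ×_X Spec P` over a generalisation of `𝔭`
  haveI : IsDominant (pullback.snd h g) := inferInstance
  obtain ⟨t, ht⟩ := exists_specializes_of_denseRange (pullback.snd h g)
    (pullback.snd h g).denseRange 𝔭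
  set ψt : P ⟶ (pullback h g).residueField t :=
    Spec.preimage ((pullback h g).fromSpecResidueField t ≫ pullback.snd h g) with hψt_def
  have hψt : Spec.map ψt = (pullback h g).fromSpecResidueField t ≫ pullback.snd h g := by
    rw [hψt_def, Spec.map_preimage]
  have hunit : ∀ s : 𝔭.asIdeal.primeCompl, IsUnit (ψt.hom s.1) := by
    intro s
    have hs : s.1 ∉ RingHom.ker ψt.hom := by
      rw [hψt_def, ker_preimage_eq_asIdeal _ (closedPoint _), Scheme.Hom.comp_apply]
      erw [Scheme.fromSpecResidueField_apply]
      exact fun hmem => s.2 (((PrimeSpectrum.le_iff_specializes _ _).mpr ht) hmem)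
    exact Ne.isUnit (fun h0 => hs (RingHom.mem_ker.mpr h0))
  -- Step 4: a valuation ring `A'` of `K' = κ(t)` centred on `𝔭`
  set ψt𝔭 : Localization.AtPrime 𝔭.asIdeal →+* (pullback h g).residueField t :=
    IsLocalization.lift (M := 𝔭.asIdeal.primeCompl) hunit with hψt𝔭_def
  obtain ⟨A', hA'range, hA'loc⟩ := IsLocalRing.exists_factor_valuationRing ψt𝔭
  obtain ⟨toA', hsubA', hkerA'⟩ : ∃ toA' : P →+* A', A'.subtype.comp toA' = ψt.hom ∧
      ∀ s ∈ 𝔭.asIdeal, IsLocalRing.residue A' (toA' s) = 0 := by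
    refine ⟨(ψt𝔭.codRestrict A'.toSubring hA'range).comp
      (algebraMap P (Localization.AtPrime 𝔭.asIdeal)), RingHom.ext fun s => ?_, fun s hs => ?_⟩
    · change ψt𝔭 (algebraMap P (Localization.AtPrime 𝔭.asIdeal) s) = ψt.hom s
      rw [hψt𝔭_def, IsLocalization.lift_eq]
    · rw [IsLocalRing.residue_eq_zero_iff, IsLocalRing.mem_maximalIdeal, mem_nonunits_iff]
      intro hu
      have hu' : IsUnit (algebraMap P (Localization.AtPrime 𝔭.asIdeal) s) :=
        (isUnit_map_iff (ψt𝔭.codRestrict A'.toSubring hA'range) _).mp hu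
      exact ((IsLocalization.AtPrime.isUnit_to_map_iff (Localization.AtPrime 𝔭.asIdeal)
        𝔭.asIdeal s).mp hu') hs
  -- Step 5: `φ : K → κ(A')`
  have hkerφ : RingHom.ker e.hom ≤ RingHom.ker ((IsLocalRing.residue A').comp toA') := fun s hs =>
    RingHom.mem_ker.mpr (hkerA' s hs)
  set φ : sq.K →+* IsLocalRing.ResidueField A' :=
    e.hom.liftOfSurjective he ⟨(IsLocalRing.residue A').comp toA', hkerφ⟩ with hφ_def
  have hφ : φ.comp e.hom = (IsLocalRing.residue A').comp toA' :=
    e.hom.liftOfSurjective_comp he ⟨_, hkerφ⟩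
  -- Step 6: a valuation ring `A''` of `κ(A')` dominating the image of `A`
  obtain ⟨A'', hA''range, hA''loc⟩ :=
    IsLocalRing.exists_factor_valuationRing (φ.comp (algebraMap sq.R sq.K))
  obtain ⟨φA'', hφA'', hA''loc⟩ : ∃ φA'' : sq.R →+* A'',
      A''.subtype.comp φA'' = φ.comp (algebraMap sq.R sq.K) ∧ IsLocalHom φA'' :=
    ⟨_, rfl, hA''loc⟩
  -- Step 7: the composite valuation ring `C` and the square over `S` it receives
  set C := residueOverringLift A' A'' with hC_def
  set γ : Γ(S, ⊤) ⟶ P := Spec.preimage (g ≫ f ≫ S.isoSpec.hom) with hγ_def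
  set σ : Γ(S, ⊤) ⟶ CommRingCat.of sq.R := Spec.preimage (sq.i₂ ≫ S.isoSpec.hom) with hσ_def
  have hγe : γ ≫ e = σ ≫ CommRingCat.ofHom (algebraMap sq.R sq.K) := by
    apply Spec.map_injective
    rw [Spec.map_comp, Spec.map_comp, hγ_def, hσ_def, Spec.map_preimage, Spec.map_preimage,
      ← Category.assoc, ← hi₁, reassoc_of% w]
  set ρ : Γ(S, ⊤) →+* A' := toA'.comp γ.hom with hρ_def
  have heγ : e.hom.comp γ.hom = (algebraMap sq.R sq.K).comp σ.hom := by
    have := congrArg CommRingCat.Hom.hom hγe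
    simpa only [CommRingCat.hom_comp, CommRingCat.hom_ofHom] using this
  have hρ : (IsLocalRing.residue A').comp ρ = A''.subtype.comp (φA''.comp σ.hom) := by
    rw [hρ_def, ← RingHom.comp_assoc, ← hφ, RingHom.comp_assoc, heγ, ← RingHom.comp_assoc,
      ← hφA'', RingHom.comp_assoc]
  have hρC : ∀ r, (ρ r : (pullback h g).residueField t) ∈ C := fun r =>
    (mem_residueOverringLift_iff A' A'' _).mpr ⟨(ρ r).2, by
      rw [show (⟨((ρ r : A') : (pullback h g).residueField t), (ρ r).2⟩ : A') = ρ r from rfl,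
        show IsLocalRing.residue A' (ρ r) = ((IsLocalRing.residue A').comp ρ) r from rfl, hρ]
      exact (φA'' (σ.hom r)).2⟩
  obtain ⟨ρC, hρC'⟩ : ∃ ρC : Γ(S, ⊤) →+* C,
      C.subtype.comp ρC = A'.subtype.comp ρ :=
    ⟨(A'.subtype.comp ρ).codRestrict C.toSubring hρC, rfl⟩
  set c₂ : Spec (CommRingCat.of C) ⟶ S := Spec.map (CommRingCat.ofHom ρC) ≫ S.isoSpec.inv with hc₂
  set u₁ : Spec ((pullback h g).residueField t) ⟶ U :=
    (pullback h g).fromSpecResidueField t ≫ pullback.fst h g with hu₁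
  have hgf : g ≫ f = Spec.map γ ≫ S.isoSpec.inv := by
    rw [hγ_def, Spec.map_preimage, Category.assoc, Category.assoc, Iso.hom_inv_id, Category.comp_id]
  have hρ' : (CommRingCat.Hom.hom ψt).comp γ.hom =
      (algebraMap C ((pullback h g).residueField t)).comp ρC := by
    change _ = C.subtype.comp ρC
    rw [hρC', hρ_def, ← RingHom.comp_assoc, hsubA']
  have hsq : u₁ ≫ h ≫ f =
      Spec.map (CommRingCat.ofHom (algebraMap C ((pullback h g).residueField t))) ≫ c₂ := by
    rw [hu₁, hc₂, Category.assoc, pullback.condition_assoc, hgf, ← Category.assoc, ← hψt,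
      ← Spec.map_comp_assoc, ← Spec.map_comp_assoc]
    congr 2
    ext1
    simpa only [CommRingCat.hom_comp, CommRingCat.hom_ofHom] using hρ'
  obtain ⟨ℓ, hℓ₁, hℓ₂⟩ := H (A := C) (K := (pullback h g).residueField t) u₁ c₂ hsq
  -- Step 8: uniqueness: the `A'`-point of `X` through `ℓ` is the one through `g`
  set a' : Spec (CommRingCat.of A') ⟶ X := Spec.map (CommRingCat.ofHom toA') ≫ g with ha'
  have ha'K : Spec.map (CommRingCat.ofHom (algebraMap A' ((pullback h g).residueField t))) ≫ a' =
      u₁ ≫ h := by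
    rw [ha', ← Spec.map_comp_assoc, hu₁, Category.assoc, pullback.condition]
    have e1 : Spec.map (CommRingCat.ofHom toA' ≫
        CommRingCat.ofHom (algebraMap A' ((pullback h g).residueField t))) = Spec.map ψt := by
      congr 1
      ext1
      rw [CommRingCat.hom_comp, CommRingCat.hom_ofHom, CommRingCat.hom_ofHom, ← hsubA']
      rfl
    rw [e1, hψt, Category.assoc]
  have hinclρ : (compositeInclusion A' A'').comp ρC = ρ := by
    refine RingHom.ext fun r => Subtype.ext ?_
    have := RingHom.congr_fun hρC' r
    exact this
  have huniq : Spec.map (CommRingCat.ofHom (compositeInclusion A' A'')) ≫ ℓ = a' := by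
    have hw : (u₁ ≫ h) ≫ f =
        Spec.map (CommRingCat.ofHom (algebraMap A' ((pullback h g).residueField t))) ≫ a' ≫ f := by
      rw [reassoc_of% ha'K, Category.assoc]
    let sq' : ValuativeCommSq f :=
      { R := A', K := (pullback h g).residueField t, i₁ := u₁ ≫ h, i₂ := a' ≫ f, commSq := ⟨hw⟩ }
    have l₁fac : Spec.map (CommRingCat.ofHom (algebraMap A' ((pullback h g).residueField t))) ≫
        Spec.map (CommRingCat.ofHom (compositeInclusion A' A'')) ≫ ℓ = u₁ ≫ h := by
      rw [← hℓ₁, ← Spec.map_comp_assoc]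
      rfl
    have l₁fac' : (Spec.map (CommRingCat.ofHom (compositeInclusion A' A'')) ≫ ℓ) ≫ f = a' ≫ f := by
      rw [Category.assoc, hℓ₂, hc₂, ha', Category.assoc, hgf, ← Spec.map_comp_assoc,
        ← Spec.map_comp_assoc]
      congr 2
      ext1
      simp only [CommRingCat.hom_comp, CommRingCat.hom_ofHom]
      rw [hinclρ, hρ_def]
    let L₁ : sq'.commSq.LiftStruct := ⟨Spec.map (CommRingCat.ofHom (compositeInclusion A' A'')) ≫ ℓ,
      l₁fac, l₁fac'⟩
    let L₂ : sq'.commSq.LiftStruct := ⟨a', ha'K, rfl⟩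
    haveI := IsSeparated.valuativeCriterion f sq'
    exact congrArg CommSq.LiftStruct.l (Subsingleton.elim L₁ L₂)
  -- Step 9: the `A''`-point `ψ` of `X`
  set ψ : Spec (CommRingCat.of A'') ⟶ X := Spec.map (CommRingCat.ofHom (compositeToResidue A' A'')) ≫ ℓ
    with hψ_def
  have hP2 : Spec.map (CommRingCat.ofHom A''.subtype) ≫ ψ =
      Spec.map (CommRingCat.ofHom φ) ≫ sq.i₁ := by
    rw [hψ_def, ← Spec.map_comp_assoc, ← CommRingCat.ofHom_comp,
      subtype_comp_compositeToResidue A' A'', CommRingCat.ofHom_comp, Spec.map_comp_assoc, huniq,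
      ha', ← Spec.map_comp_assoc, ← CommRingCat.ofHom_comp, ← hφ, CommRingCat.ofHom_comp,
      CommRingCat.ofHom_hom, Spec.map_comp_assoc, ← hi₁]
  have hsqi₂ : sq.i₂ = Spec.map σ ≫ S.isoSpec.inv := by
    rw [hσ_def, Spec.map_preimage, Category.assoc, Iso.hom_inv_id, Category.comp_id]
  have hP1 : Spec.map (CommRingCat.ofHom φA'') ≫ sq.i₂ = ψ ≫ f := by
    rw [hψ_def, Category.assoc, hℓ₂, hc₂, hsqi₂, ← Spec.map_comp_assoc, ← Spec.map_comp_assoc]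
    congr 2
    ext1
    simp only [CommRingCat.hom_comp, CommRingCat.hom_ofHom]
    refine RingHom.ext fun r => Subtype.ext ?_
    have h1 := RingHom.congr_fun hρ r
    have h2 := RingHom.congr_fun (subtype_comp_compositeToResidue A' A'') (ρC r)
    simp only [RingHom.comp_apply] at h1 h2
    have h3 := RingHom.congr_fun hinclρ r
    rw [RingHom.comp_apply] at h3
    change A''.subtype (φA'' (σ.hom r)) = A''.subtype ((compositeToResidue A' A'') (ρC r))
    rw [← h1, h2, h3]
  -- Step 10: base change to `Spec A` and conclusion
  set ψ' : Spec (CommRingCat.of A'') ⟶ pullback sq.i₂ f :=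
    pullback.lift (Spec.map (CommRingCat.ofHom φA'')) ψ hP1 with hψ'
  set lft := pullback.lift (Spec.map (CommRingCat.ofHom (algebraMap sq.R sq.K))) sq.i₁ w.symm
    with hlft
  have hgen : Spec.map (CommRingCat.ofHom A''.subtype) ≫ ψ' =
      Spec.map (CommRingCat.ofHom φ) ≫ lft := by
    apply pullback.hom_ext
    · rw [Category.assoc, Category.assoc, hψ', hlft, pullback.lift_fst, pullback.lift_fst,
        ← Spec.map_comp, ← Spec.map_comp, ← CommRingCat.ofHom_comp, ← CommRingCat.ofHom_comp,
        hφA'']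
    · rw [Category.assoc, Category.assoc, hψ', hlft, pullback.lift_snd, pullback.lift_snd, hP2]
  haveI : IsLocalHom φA'' := hA''loc
  refine hasLift_of_specializes sq (ψ' (closedPoint A'')) ?_ ?_
  · change lft (closedPoint sq.K) ⤳ ψ' (closedPoint A'')
    have key : (Spec.map (CommRingCat.ofHom A''.subtype) ≫ ψ')
        (closedPoint (IsLocalRing.ResidueField A')) =
          (Spec.map (CommRingCat.ofHom φ) ≫ lft) (closedPoint (IsLocalRing.ResidueField A')) := by
      rw [hgen]
    rw [Scheme.Hom.comp_apply, Scheme.Hom.comp_apply,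
      Subsingleton.elim (Spec.map (CommRingCat.ofHom φ) (closedPoint (IsLocalRing.ResidueField A')))
        (closedPoint sq.K)] at key
    rw [← key]
    exact (IsLocalRing.specializes_closedPoint _).map ψ'.continuous
  · rw [← Scheme.Hom.comp_apply, hψ', pullback.lift_fst]
    have hcl := IsLocalRing.comap_closedPoint φA''
    exact hcl

end Core

/-! ### General base -/

section General

variable {U X S : Scheme.{u}} (h : U ⟶ X) (f : X ⟶ S)

set_option backward.isDefEq.respectTransparency false in
/-- **Stacks 0894, existence part of the valuative criterion**: `h : U → X` quasi-compact and
scheme-theoretically dominant, `f : X → S` separated; if every valuative square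
(`Spec K → U → X`, `Spec A → S`) has a lift, then EVERY valuative square for `f` has a lift.
Reduction to `existence_of_existence_comp_of_isAffine` ("We may also replace `S` by an affine
open through which the morphism `Spec(A) → S` factors", restricting `X`, `U` accordingly: the
hypotheses are inherited by `h|_{f⁻¹W}` — scheme-theoretic dominance by flat base change along the
open immersion — and `f|_W`). [cite: StacksProject, Tag 0894] -/
theorem existence_of_existence_comp [QuasiCompact h] [IsSchemeTheoreticallyDominant h]
    [IsSeparated f]
    (H : ∀ ⦃A K : Type u⦄ [CommRing A] [IsDomain A] [ValuationRing A] [Field K] [Algebra A K]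
      [IsFractionRing A K] (u : Spec (.of K) ⟶ U) (s : Spec (.of A) ⟶ S),
      u ≫ h ≫ f = Spec.map (CommRingCat.ofHom (algebraMap A K)) ≫ s →
      ∃ l : Spec (.of A) ⟶ X, Spec.map (CommRingCat.ofHom (algebraMap A K)) ≫ l = u ≫ h ∧
        l ≫ f = s) :
    ValuativeCriterion.Existence f := by
  intro sq
  have w : sq.i₁ ≫ f = Spec.map (CommRingCat.ofHom (algebraMap sq.R sq.K)) ≫ sq.i₂ := sq.commSq.w
  -- an affine open `W ⊆ S` containing the image of the closed point, hence all of `Spec A`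
  obtain ⟨W, hW, hsW⟩ : ∃ W : S.Opens, IsAffineOpen W ∧ sq.i₂ (closedPoint sq.R) ∈ W := by
    obtain ⟨_, ⟨W, hW, rfl⟩, hsW, -⟩ := S.isBasis_affineOpens.exists_subset_of_mem_open
      (Set.mem_univ (sq.i₂ (closedPoint sq.R))) isOpen_univ
    exact ⟨W, hW, hsW⟩
  haveI : IsAffine W := hW
  have hrange₂ : Set.range sq.i₂ ⊆ Set.range W.ι := by
    rw [Scheme.Opens.range_ι]
    rintro _ ⟨p, rfl⟩
    exact ((IsLocalRing.specializes_closedPoint p).map sq.i₂.continuous).mem_open W.2 hsW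
  have hrange₁ : Set.range sq.i₁ ⊆ Set.range (f ⁻¹ᵁ W).ι := by
    rw [Scheme.Opens.range_ι]
    rintro _ ⟨p, rfl⟩
    show f (sq.i₁ p) ∈ W
    rw [← Scheme.Hom.comp_apply, w, Scheme.Hom.comp_apply]
    have := hrange₂ ⟨Spec.map (CommRingCat.ofHom (algebraMap sq.R sq.K)) p, rfl⟩
    rwa [Scheme.Opens.range_ι] at this
  -- the restricted data `h' : h⁻¹(f⁻¹ W) → f⁻¹ W`, `f' : f⁻¹ W → W`
  haveI : IsSchemeTheoreticallyDominant (h ∣_ (f ⁻¹ᵁ W)) :=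
    IsSchemeTheoreticallyDominant.of_isPullback (isPullback_morphismRestrict h (f ⁻¹ᵁ W)).flip
  have H' : ∀ ⦃A K : Type u⦄ [CommRing A] [IsDomain A] [ValuationRing A] [Field K] [Algebra A K]
      [IsFractionRing A K] (u : Spec (.of K) ⟶ ↑(h ⁻¹ᵁ (f ⁻¹ᵁ W))) (s : Spec (.of A) ⟶ W),
      u ≫ (h ∣_ (f ⁻¹ᵁ W)) ≫ (f ∣_ W) = Spec.map (CommRingCat.ofHom (algebraMap A K)) ≫ s →
      ∃ l : Spec (.of A) ⟶ ↑(f ⁻¹ᵁ W), Spec.map (CommRingCat.ofHom (algebraMap A K)) ≫ l =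
        u ≫ (h ∣_ (f ⁻¹ᵁ W)) ∧ l ≫ (f ∣_ W) = s := by
    intro A K _ _ _ _ _ _ u s hus
    have hus' : (u ≫ (h ⁻¹ᵁ (f ⁻¹ᵁ W)).ι) ≫ h ≫ f =
        Spec.map (CommRingCat.ofHom (algebraMap A K)) ≫ s ≫ W.ι := by
      have := congrArg (· ≫ W.ι) hus
      simp only [Category.assoc, morphismRestrict_ι, morphismRestrict_ι_assoc] at this
      simpa only [Category.assoc] using this
    obtain ⟨l, hl₁, hl₂⟩ := H (u ≫ (h ⁻¹ᵁ (f ⁻¹ᵁ W)).ι) (s ≫ W.ι) hus'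
    have hlrange : Set.range l ⊆ Set.range (f ⁻¹ᵁ W).ι := by
      rw [Scheme.Opens.range_ι]
      rintro _ ⟨p, rfl⟩
      show f (l p) ∈ W
      rw [← Scheme.Hom.comp_apply, hl₂, Scheme.Hom.comp_apply, Scheme.Opens.ι_apply]
      exact (s p).2
    refine ⟨IsOpenImmersion.lift (f ⁻¹ᵁ W).ι l hlrange, ?_, ?_⟩
    · rw [← cancel_mono (f ⁻¹ᵁ W).ι, Category.assoc, IsOpenImmersion.lift_fac, hl₁, Category.assoc,
        Category.assoc, morphismRestrict_ι]
    · rw [← cancel_mono W.ι, Category.assoc, morphismRestrict_ι, IsOpenImmersion.lift_fac_assoc, hl₂]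
  have hcore := existence_of_existence_comp_of_isAffine (h ∣_ (f ⁻¹ᵁ W)) (f ∣_ W) H'
  -- the restricted square
  have wsq : IsOpenImmersion.lift (f ⁻¹ᵁ W).ι sq.i₁ hrange₁ ≫ (f ∣_ W) =
      Spec.map (CommRingCat.ofHom (algebraMap sq.R sq.K)) ≫ IsOpenImmersion.lift W.ι sq.i₂ hrange₂ := by
    rw [← cancel_mono W.ι, Category.assoc, Category.assoc, morphismRestrict_ι,
      IsOpenImmersion.lift_fac_assoc, IsOpenImmersion.lift_fac, w]
  let sq' : ValuativeCommSq (f ∣_ W) :=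
    { R := sq.R, K := sq.K, i₁ := IsOpenImmersion.lift (f ⁻¹ᵁ W).ι sq.i₁ hrange₁,
      i₂ := IsOpenImmersion.lift W.ι sq.i₂ hrange₂, commSq := ⟨wsq⟩ }
  obtain ⟨l₀, hl₀₁, hl₀₂⟩ := (hcore sq').exists_lift
  refine ⟨⟨⟨l₀ ≫ (f ⁻¹ᵁ W).ι, ?_, ?_⟩⟩⟩
  · rw [reassoc_of% hl₀₁, IsOpenImmersion.lift_fac]
  · rw [Category.assoc, ← morphismRestrict_ι, reassoc_of% hl₀₂, IsOpenImmersion.lift_fac]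

/-- **Stacks 0894 (refined valuative criterion), universal closedness.** Let `h : U → X` be
quasi-compact and scheme-theoretically dominant and `f : X → S` quasi-compact and separated. If
every valuative square whose `K`-point comes from `U` has a lift, then `f` is universally closed
(Tag 01KF applied to `existence_of_existence_comp`). [cite: StacksProject, Tag 0894] -/
theorem universallyClosed_of_valuativeCriterion_comp [QuasiCompact h]
    [IsSchemeTheoreticallyDominant h] [QuasiCompact f] [IsSeparated f]
    (H : ∀ ⦃A K : Type u⦄ [CommRing A] [IsDomain A] [ValuationRing A] [Field K] [Algebra A K]
      [IsFractionRing A K] (u : Spec (.of K) ⟶ U) (s : Spec (.of A) ⟶ S),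
      u ≫ h ≫ f = Spec.map (CommRingCat.ofHom (algebraMap A K)) ≫ s →
      ∃ l : Spec (.of A) ⟶ X, Spec.map (CommRingCat.ofHom (algebraMap A K)) ≫ l = u ≫ h ∧
        l ≫ f = s) :
    UniversallyClosed f :=
  UniversallyClosed.of_valuativeCriterion f (existence_of_existence_comp h f H)

/-- **Stacks 0894, properness form**: under the same hypotheses, if `f` is moreover locally of
finite type then it is proper (this is how Tag 0F40 concludes: "As `W → S` is already of finite
type and separated, we win"). [cite: StacksProject, Tag 0894] -/
theorem isProper_of_valuativeCriterion_comp [QuasiCompact h]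
    [IsSchemeTheoreticallyDominant h] [QuasiCompact f] [IsSeparated f] [LocallyOfFiniteType f]
    (H : ∀ ⦃A K : Type u⦄ [CommRing A] [IsDomain A] [ValuationRing A] [Field K] [Algebra A K]
      [IsFractionRing A K] (u : Spec (.of K) ⟶ U) (s : Spec (.of A) ⟶ S),
      u ≫ h ≫ f = Spec.map (CommRingCat.ofHom (algebraMap A K)) ≫ s →
      ∃ l : Spec (.of A) ⟶ X, Spec.map (CommRingCat.ofHom (algebraMap A K)) ≫ l = u ≫ h ∧
        l ≫ f = s) :
    IsProper f :=
  haveI := universallyClosed_of_valuativeCriterion_comp h f H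
  { }

end General

end Literature.AlgebraicGeometry.Morphisms

end
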